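import Summits.ResolutionOfSingularities.ResolutionOfSingularities.Theorems.PurelyInseparableDim4ParamLiftNormal
import Summits.ResolutionOfSingularities.ResolutionOfSingularities.Theorems.PurelyInseparableDim4ParamCertTree
import HarnessLib

/-!
# [OURS · res-dim4-pi · F4-C-loc] PARAMETRIC CERTIFICATES, format v6 (part 1: the FORMAT): chart trees that CONTINUE after
  pinning a fibre coordinate (to zero, to a rational root, to a root of a quadratic, to the letter), on NORMALISED data

Cell `res-dim4-pi` (D-0157 DOOR 2, wave 2), seat `res-dim4-p-6` g4; sequel of `…ParamCertTree` (v4/v5) over the kit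
`…ParamLiftNormal` (part 5).  v6 keeps the rows of v4 (`Terms 5 k`, one fibre letter; row kinds blind | coat | move) and
changes the chart tree in one respect: a node now carries the CURRENT chart data `G` (the chart transform translated by the
coordinates pinned so far, in normal form `normT`) — so every branch of a reply-locus case split continues with a full
subtree instead of ending in «later row or dead»:

* `dead γ` (`pwitB` on the current, normalised data — collected coefficients) · `child` (`U = ∅`; origin child `0` or a
  later row) · `free i zero letter` (`G` t-free: `bᵢ = 0` continues in `zero`; `bᵢ = β' ≠ 0` becomes THE letter and
  continues in `letter` on `normT (shearL i G)`) · `roots γ i tr M A d₀ zero rts qds` (§0 `prootsMB`: the collected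
  constraint on `bᵢ` IS `β^M·R(bᵢ/β^{tr})`, `R = A·T^{d₀}·∏(T−ρ)^m·∏(T²−c₁T−c₀)^m`; `bᵢ = 0` continues in `zero` (checked
  iff `d₀ > 0`), each monomial root `f ρ·β^{tr}` continues on `normT (shearMonoL i ρ tr G)`, each quadratic (`tr = 0`,
  `G` t-free) on `normT (reduceQ c₁ c₀ (shearL i G))`, which must be LETTER-FREE) · `pair γ i i' ρ d zero letter` (`ppairB`, `G` t-free:
  `b_{i'} = 0` continues in `zero`, `b_{i'} = β'` the letter continues in `letter` on `normT (shearMonoL i ρ d (shearL i' G))`)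
  · `rel` / `split` as v4.
* checkers `pnode6B` / `pforest6B` / `proots6B` / `pquads6B` (mutual structural recursion), `prow6B`, **`pcert6B`**; the
  soundness theorem is part 2 (`…ParamCertSixSound`).

Every v5 certificate has a v6 transcription (`free i` ↦ `free i child child`, `root γ i ρ at` ↦ `roots γ i 0 0 A d · [((ρ,1),·)] []`,
`pair … sub` ↦ `pair … sub child|dead`).  [OURS · counted 0 · certificate format; AI kernel work, weaker than expert
review.]  NOTHING here is a statement about resolution of singularities; resolution in dimension `≥ 4` / characteristic
`p > 0` is NOT proved by anything in this file.  bears_on: LADDER-RESOLUTION:D157-DOOR2 (res-dim4-pi · F4-C-loc all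
fields · parametric rows v6).  Host item (DR-157-C): `stmt-ResolutionOfSingularities-16155`, helper.
-/

set_option linter.dupNamespace false -- mandated namespace of this single-conjunct summit

noncomputable section

open MvPolynomial Finset
open scoped BigOperators

namespace Summit.ResolutionOfSingularities.ResolutionOfSingularities.Theorems.PIDim4

namespace ParamLift

open Literature.AlgebraicGeometry.Resolution
open StepKit

variable {k K : Type} [Field k] [Field K] [DecidableEq k] [DecidableEq K] (f : k →+* K) (β : K)

/-! ## §0 Kit addendum: MONOMIAL roots `bᵢ = f ρ·β^{tr}` (root-set check at a lettered chart) -/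

omit [DecidableEq k] [DecidableEq K] in
/-- **translation by a monomial root**: moving `xᵢ` by `f ρ·β^d` is `shearMonoAlg i ρ d` on the data. OURS. [folklore] -/
theorem translate_mono_spec (i : Fin 4) (ρ : k) (d : ℕ) (P : MvPolynomial (Fin 5) k) :
    PointBlowup.translate (Pi.single i (f ρ * β ^ d)) (spec f β P) = spec f β (shearMonoAlg i ρ d P) := by
  have h1 : (aeval fun m : Fin 4 => (X m + C ((Pi.single i (f ρ * β ^ d) : Fin 4 → K) m) :
      MvPolynomial (Fin 4) K)).toRingHom.comp (spec f β) = (spec f β).comp (shearMonoAlg i ρ d (k := k)).toRingHom := by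
    refine MvPolynomial.ringHom_ext (fun c => ?_) (fun m => ?_)
    · simp [spec, shearMonoAlg]
    · rw [RingHom.comp_apply, RingHom.comp_apply]
      show aeval _ (spec f β (X m)) = spec f β (shearMonoAlg i ρ d (X m))
      rw [shearMonoAlg_X]
      induction m using Fin.lastCases with
      | last => rw [spec_X_last, aeval_C, algebraMap_eq, if_neg (Fin.castSucc_lt_last i).ne', spec_X_last]
      | cast m =>
        rw [spec_X_castSucc, aeval_X]
        by_cases hm : m = i
        · subst hm
          rw [if_pos rfl, Pi.single_eq_same, map_add (spec f β), map_mul (spec f β), map_pow (spec f β), spec_X_castSucc,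
            spec_C, spec_X_last, ← C_pow, ← map_mul C]
        · rw [if_neg (fun h => hm (Fin.castSucc_injective _ h)), spec_X_castSucc, Pi.single_eq_of_ne hm, C_0, add_zero]
  exact congrArg (fun φ : MvPolynomial (Fin 5) k →+* MvPolynomial (Fin 4) K => φ P) h1

/-- **monomial root-set check** for the letter `i ∈ U`: as `prootsB` (part 5), but the sources' letter powers `a_t` need
only be AFFINE in the `bᵢ`-degree, `a_t + tr·d_t = M` — then the constraint is `β^M·R(bᵢ/β^{tr})` with `R` the certified
factorisation, and the roots are `bᵢ = f ρ·β^{tr}` (quadratic factors only when `tr = 0`). OURS. [folklore] -/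
def prootsMB (q : ℕ) (U : Finset (Fin 4)) (G : Terms 5 k) (γ : Fin 4 → ℕ) (i : Fin 4) (tr M : ℕ) (A : k) (d₀ : ℕ)
    (rts : List (k × ℕ)) (qds : List (k × k × ℕ)) : Bool :=
  !decide (γ = 0) && decide (∑ m, γ m < q) && decide (i ∈ U) && !decide (A = 0) &&
    (decide (tr = 0) || decide (qds = [])) &&
    decide (∀ t ∈ srcTerms U γ G, (∀ m : Fin 4, m ≠ i → t.1 m.castSucc = γ m) ∧
      t.1 (Fin.last 4) + tr * (t.1 i.castSucc - γ i) = M ∧ t.1 i.castSucc - γ i < (rootsPolyL A d₀ rts qds).length) &&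
    (List.range (rootsPolyL A d₀ rts qds).length).all fun d =>
      decide (uCoef γ i (srcTerms U γ G) d = (rootsPolyL A d₀ rts qds).getD d 0)

omit [Field K] [DecidableEq K] in
/-- the low-exponent data of a monomial root-set check. OURS. [folklore] -/
theorem prootsMB_low {q : ℕ} {U : Finset (Fin 4)} {G : Terms 5 k} {γ : Fin 4 → ℕ} {i : Fin 4} {tr M : ℕ} {A : k}
    {d₀ : ℕ} {rts : List (k × ℕ)} {qds : List (k × k × ℕ)} (h : prootsMB q U G γ i tr M A d₀ rts qds = true) :
    γ ≠ 0 ∧ ∑ m, γ m < q := by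
  unfold prootsMB at h
  simp only [Bool.and_eq_true, Bool.not_eq_true', decide_eq_false_iff_not, decide_eq_true_eq] at h
  exact ⟨h.1.1.1.1.1.1, h.1.1.1.1.1.2⟩

omit [DecidableEq K] in
/-- **a monomial root-set check pins the letter**: if the coefficient of `x^γ` vanishes at `b` (vanishing off `U`, `β ≠ 0`)
then `bᵢ = 0` (only if `d₀ > 0`), or `bᵢ = f ρ·β^{tr}` for a listed `ρ`, or (`tr = 0`) `bᵢ` is a root of a listed
quadratic. OURS. [folklore] -/
theorem coord_cases_of_prootsMB (hβ : β ≠ 0) {q : ℕ} {U : Finset (Fin 4)} {G : Terms 5 k} {γ : Fin 4 → ℕ} {i : Fin 4}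
    {tr M : ℕ} {A : k} {d₀ : ℕ} {rts : List (k × ℕ)} {qds : List (k × k × ℕ)}
    (h : prootsMB q U G γ i tr M A d₀ rts qds = true) {b : Fin 4 → K} (hb : ∀ m : Fin 4, m ∉ U → b m = 0)
    (hzero : coeff (expo γ) (PointBlowup.translate b (spec f β (evalT G))) = 0) :
    (0 < d₀ ∧ b i = 0) ∨ (∃ ρm ∈ rts, b i = f ρm.1 * β ^ tr) ∨
      (tr = 0 ∧ ∃ c ∈ qds, b i ^ 2 = f c.1 * b i + f c.2.1) := by
  unfold prootsMB at h
  simp only [Bool.and_eq_true, Bool.not_eq_true', decide_eq_false_iff_not, decide_eq_true_eq, Bool.or_eq_true,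
    List.all_eq_true, List.mem_range] at h
  obtain ⟨⟨⟨⟨-, hA⟩, htrq⟩, hsrc⟩, hcoef⟩ := h
  set R := rootsPolyL A d₀ rts qds with hR
  set y : K := b i * (β ^ tr)⁻¹ with hy
  have hβt : β ^ tr ≠ 0 := pow_ne_zero _ hβ
  have hby : b i = y * β ^ tr := by rw [hy, inv_mul_cancel_right₀ hβt]
  rw [coeff_translate_spec_evalT, sum_pterm_filter f β γ hb] at hzero
  change ((srcTerms U γ G).map (pterm f β γ b)).sum = 0 at hzero
  have hmap : (srcTerms U γ G).map (pterm f β γ b) = (srcTerms U γ G).map fun t => β ^ M *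
      (f (t.2 * (((t.1 i.castSucc).choose (γ i) : ℕ) : k)) * y ^ (t.1 i.castSucc - γ i)) :=
    List.map_congr_left fun t ht => by
      rw [pterm_eq_of_moves_only f β γ b (hsrc t ht).1, ← (hsrc t ht).2.1, hby, mul_pow, ← pow_mul, pow_add]
      ring
  rw [hmap, List.sum_map_mul_left] at hzero
  have hsum : ((srcTerms U γ G).map fun t =>
      f (t.2 * (((t.1 i.castSucc).choose (γ i) : ℕ) : k)) * y ^ (t.1 i.castSucc - γ i)).sum = 0 :=
    (mul_eq_zero.mp hzero).resolve_left (pow_ne_zero _ hβ)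
  rw [sum_src_eq_sum_uCoef f γ i y R.length _ (fun t ht => (hsrc t ht).2.2)] at hsum
  have hev : evalL f R y = 0 := by
    rw [evalL_eq_sum, ← hsum]
    exact Finset.sum_congr rfl fun d hd => by rw [hcoef d (Finset.mem_range.mp hd)]
  rcases root_cases_of_eval_eq_zero f hA hev with ⟨hd, hy0⟩ | ⟨ρm, hρm, hyρ⟩ | ⟨c, hc, hyc⟩
  · exact Or.inl ⟨hd, by rw [hby, hy0, zero_mul]⟩
  · exact Or.inr (Or.inl ⟨ρm, hρm, by rw [hby, hyρ]⟩)
  · rcases htrq with htr | hq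
    · refine Or.inr (Or.inr ⟨htr, c, hc, ?_⟩)
      have : y = b i := by rw [hby, htr, pow_zero, mul_one]
      rw [← this]; exact hyc
    · rw [hq] at hc; exact absurd hc List.not_mem_nil

end ParamLift

namespace LoopCLocal

open Literature.AlgebraicGeometry.Resolution
open Literature.AlgebraicGeometry.Resolution.CentreBlowup
open StepKit ParamLift

section Format

variable {k : Type} [Field k] [DecidableEq k]

/-! ## §1 The v6 tree format -/

/-- a v6 chart-tree node, read against CURRENT chart data `G` and free fibre coordinates `U` (module docstring).
OURS. [folklore] -/
inductive PNode6 (k : Type) : Type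
  /-- no equimultiple point remains: witness `γ` (collected coefficient) -/
  | dead (γ : Fin 4 → ℕ)
  /-- all coordinates pinned: the child `clean4 q G` is `0` or a later row -/
  | child
  /-- `bᵢ = 0` continues in `zero`; `bᵢ ≠ 0` becomes the letter and continues in `letter` (`G` t-free) -/
  | free (i : Fin 4) (zero letter : PNode6 k)
  /-- certified root set of the constraint on `bᵢ` (sources of `γ`, letter powers `M − tr·deg`): zero branch (iff
  `d₀ > 0`), a subtree per monomial root `f ρ·β^{tr}`, a subtree per quadratic factor (rational continuation) -/
  | roots (γ : Fin 4 → ℕ) (i : Fin 4) (tr M : ℕ) (A : k) (d₀ : ℕ) (zero : PNode6 k)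
      (rts : List ((k × ℕ) × PNode6 k)) (qds : List ((k × k × ℕ) × PNode6 k))
  /-- tie `bᵢ = f ρ·b_{i'}^d`: `b_{i'} = 0` continues in `zero`, `b_{i'} ≠ 0` becomes the letter and continues in `letter` -/
  | pair (γ : Fin 4 → ℕ) (i i' : Fin 4) (ρ : k) (d : ℕ) (zero letter : PNode6 k)
  /-- binomial relation: some `bᵢ = 0`, `i ∈ zs`; subtrees per coordinate -/
  | rel (γ γ' : Fin 4 → ℕ) (zs : Finset (Fin 4)) (nu : Fin 4 → ℕ) (κ : k) (subs : List (Fin 4 × PNode6 k))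
  /-- product forcing: some listed coordinate vanishes; subtrees per coordinate -/
  | split (γ : Fin 4 → ℕ) (subs : List (Fin 4 × PNode6 k))

/-- a v6 row certificate (as v4: blind | coat | move). OURS. [folklore] -/
inductive PRowCert6 (k : Type) : Type
  /-- t-free row outside the coordinate scope: monomial-curve data for `ScopeBlind.blindB` -/
  | blind (c : Fin 4 → k) (w : Fin 4 → ℕ) (α₀ : Fin 4 → ℕ) (a : Fin 4 → k)
  /-- t-free row outside the coordinate scope: a monomial coat (`pcoatB`) -/
  | coat (m e₀ : Fin 4 → ℕ) (ex : Fin 4 → (Fin 4 → ℕ))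
  /-- A plays `V(x_S)`; a chart tree for every `j ∈ S` -/
  | move (S : Finset (Fin 4)) (charts : Fin 4 → PNode6 k)

/-- a v6 row. OURS. [folklore] -/
abbrev PRow6 (k : Type) : Type := Terms 5 k × PRowCert6 k

/-- `L` presents the same polynomial as some LATER row. OURS. [folklore] -/
def memRow6B (L : Terms 5 k) (rest : List (PRow6 k)) : Bool := rest.any fun r => StepKit.equivB L r.1

/-- a child is fine if it is `0` or a later row. OURS. [folklore] -/
def pchild6B (L : Terms 5 k) (rest : List (PRow6 k)) : Bool := StepKit.equivB L [] || memRow6B L rest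

mutual
/-- **node checker v6** against current data `G`, free coordinates `U` (module docstring). OURS. [folklore] -/
def pnode6B (q : ℕ) (rest : List (PRow6 k)) : Terms 5 k → Finset (Fin 4) → PNode6 k → Bool
  | G, U, .dead γ => pwitB q U G γ
  | G, U, .child => decide (U = ∅) && pchild6B (clean4 q G) rest
  | G, U, .free i zero letter => decide (i ∈ U) && tfreeB G && pnode6B q rest G (U.erase i) zero &&
      pnode6B q rest (normT (shearL i G)) (U.erase i) letter
  | G, U, .roots γ i tr M A d₀ zero rts qds =>
      prootsMB q U G γ i tr M A d₀ (rts.map Prod.fst) (qds.map Prod.fst) &&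
      (decide (d₀ = 0) || pnode6B q rest G (U.erase i) zero) &&
      proots6B q rest G (U.erase i) i tr rts &&
      (decide (qds = []) || tfreeB G) && pquads6B q rest G (U.erase i) i qds
  | G, U, .pair γ i i' ρ d zero letter => tfreeB G && ppairB q U G γ i i' ρ d &&
      pnode6B q rest G (U.erase i') zero &&
      pnode6B q rest (normT (shearMonoL i ρ d (shearL i' G))) ((U.erase i).erase i') letter
  | G, U, .rel γ γ' zs nu κ subs => prelB q U G γ γ' zs nu κ && decide (zs ⊆ (subs.map Prod.fst).toFinset) &&
      pforest6B q rest G U subs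
  | G, U, .split γ subs => psplitB q U G γ (subs.map Prod.fst).toFinset && pforest6B q rest G U subs
/-- subtree-list checker: each `(i, t)` is checked with `i` removed from the free coordinates. OURS. [folklore] -/
def pforest6B (q : ℕ) (rest : List (PRow6 k)) : Terms 5 k → Finset (Fin 4) → List (Fin 4 × PNode6 k) → Bool
  | _, _, [] => true
  | G, U, (i, t) :: subs => pnode6B q rest G (U.erase i) t && pforest6B q rest G U subs
/-- monomial-root list checker: the subtree of `ρ` is checked on `normT (shearMonoL i ρ tr G)`. OURS. [folklore] -/
def proots6B (q : ℕ) (rest : List (PRow6 k)) :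
    Terms 5 k → Finset (Fin 4) → Fin 4 → ℕ → List ((k × ℕ) × PNode6 k) → Bool
  | _, _, _, _, [] => true
  | G, U', i, tr, (ρm, t) :: rts =>
      pnode6B q rest (normT (shearMonoL i ρm.1 tr G)) U' t && proots6B q rest G U' i tr rts
/-- quadratic-factor list checker: the subtree of `T² − c₁T − c₀` is checked on `normT (reduceQ c₁ c₀ (shearL i G))`,
which must be letter-free. OURS. [folklore] -/
def pquads6B (q : ℕ) (rest : List (PRow6 k)) :
    Terms 5 k → Finset (Fin 4) → Fin 4 → List ((k × k × ℕ) × PNode6 k) → Bool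
  | _, _, _, [] => true
  | G, U', i, (c, t) :: qds => tfreeB (normT (reduceQ c.1 c.2.1 (shearL i G))) &&
      pnode6B q rest (normT (reduceQ c.1 c.2.1 (shearL i G))) U' t && pquads6B q rest G U' i qds
end

/-- the v6 row check. OURS. [folklore] -/
def prow6B (q : ℕ) (rest : List (PRow6 k)) : PRow6 k → Bool
  | (L, PRowCert6.blind c w α₀ a) => tfreeB L && ScopeBlind.blindB q (⟨trunc L, 0, ∅⟩ : SData 4 k) c w α₀ a
  | (L, PRowCert6.coat m e₀ ex) => pcoatB q L m e₀ ex
  | (L, PRowCert6.move S ch) => ppermB q S L &&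
      decide (∀ j ∈ S, pnode6B q rest (chartL q (S5 S) j.castSucc L) (S.erase j) (ch j) = true)

/-- **the v6 certificate checker**: rows in order, children later. OURS. [folklore] -/
def pcert6B (q : ℕ) : List (PRow6 k) → Bool
  | [] => true
  | row :: rest => prow6B q rest row && pcert6B q rest

/-! ## §2 Heights (the recursion measure of the soundness argument) -/

mutual
/-- the height of a v6 tree. OURS. [folklore] -/
def pheight6 : PNode6 k → ℕ
  | .dead _ => 0
  | .child => 0
  | .free _ zero letter => max (pheight6 zero) (pheight6 letter) + 1
  | .roots _ _ _ _ _ _ zero rts qds => max (pheight6 zero) (max (pheightR6 rts) (pheightQ6 qds)) + 1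
  | .pair _ _ _ _ _ zero letter => max (pheight6 zero) (pheight6 letter) + 1
  | .rel _ _ _ _ _ subs => pheightL6 subs + 1
  | .split _ subs => pheightL6 subs + 1
/-- the maximal height in a subtree list. OURS. [folklore] -/
def pheightL6 : List (Fin 4 × PNode6 k) → ℕ
  | [] => 0
  | (_, t) :: subs => max (pheight6 t) (pheightL6 subs)
/-- the maximal height in a rational-root list. OURS. [folklore] -/
def pheightR6 : List ((k × ℕ) × PNode6 k) → ℕ
  | [] => 0
  | (_, t) :: rts => max (pheight6 t) (pheightR6 rts)
/-- the maximal height in a quadratic-factor list. OURS. [folklore] -/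
def pheightQ6 : List ((k × k × ℕ) × PNode6 k) → ℕ
  | [] => 0
  | (_, t) :: qds => max (pheight6 t) (pheightQ6 qds)
end

omit [Field k] [DecidableEq k] in
/-- a member subtree is lower than the list's maximum. OURS. [folklore] -/
theorem pheight6_le_of_memL : ∀ (subs : List (Fin 4 × PNode6 k)) (i : Fin 4) (t : PNode6 k), (i, t) ∈ subs →
    pheight6 t ≤ pheightL6 subs
  | [], _, _, hm => absurd hm List.not_mem_nil
  | (i₀, t₀) :: subs, i, t, hm => by
    rw [pheightL6]
    rcases List.mem_cons.mp hm with hh | ht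
    · rw [(Prod.mk.inj hh).2]; exact le_max_left _ _
    · exact le_trans (pheight6_le_of_memL subs i t ht) (le_max_right _ _)

omit [Field k] [DecidableEq k] in
/-- a member subtree is lower than the root list's maximum. OURS. [folklore] -/
theorem pheight6_le_of_memR : ∀ (rts : List ((k × ℕ) × PNode6 k)) (ρm : k × ℕ) (t : PNode6 k), (ρm, t) ∈ rts →
    pheight6 t ≤ pheightR6 rts
  | [], _, _, hm => absurd hm List.not_mem_nil
  | (ρ₀, t₀) :: rts, ρm, t, hm => by
    rw [pheightR6]
    rcases List.mem_cons.mp hm with hh | ht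
    · rw [(Prod.mk.inj hh).2]; exact le_max_left _ _
    · exact le_trans (pheight6_le_of_memR rts ρm t ht) (le_max_right _ _)

omit [Field k] [DecidableEq k] in
/-- a member subtree is lower than the quadratic list's maximum. OURS. [folklore] -/
theorem pheight6_le_of_memQ : ∀ (qds : List ((k × k × ℕ) × PNode6 k)) (c : k × k × ℕ) (t : PNode6 k),
    (c, t) ∈ qds → pheight6 t ≤ pheightQ6 qds
  | [], _, _, hm => absurd hm List.not_mem_nil
  | (c₀, t₀) :: qds, c, t, hm => by
    rw [pheightQ6]
    rcases List.mem_cons.mp hm with hh | ht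
    · rw [(Prod.mk.inj hh).2]; exact le_max_left _ _
    · exact le_trans (pheight6_le_of_memQ qds c t ht) (le_max_right _ _)

/-! ## §3 Unpacking the list checkers -/

/-- the subtree filed under a coordinate passes the node check with that coordinate removed. OURS. [folklore] -/
theorem pnode6B_of_mem_forest {q : ℕ} {rest : List (PRow6 k)} {G : Terms 5 k} :
    ∀ (subs : List (Fin 4 × PNode6 k)) (U : Finset (Fin 4)), pforest6B q rest G U subs = true →
      ∀ (i : Fin 4) (t : PNode6 k), (i, t) ∈ subs → pnode6B q rest G (U.erase i) t = true
  | [], _, _, _, _, hm => absurd hm List.not_mem_nil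
  | (i₀, t₀) :: subs, U, h, i, t, hm => by
    simp only [pforest6B, Bool.and_eq_true] at h
    rcases List.mem_cons.mp hm with hh | ht
    · rw [(Prod.mk.inj hh).1, (Prod.mk.inj hh).2]; exact h.1
    · exact pnode6B_of_mem_forest subs U h.2 i t ht

/-- the subtree filed under a monomial root passes the node check on the sheared data. OURS. [folklore] -/
theorem pnode6B_of_mem_roots {q : ℕ} {rest : List (PRow6 k)} {G : Terms 5 k} {U' : Finset (Fin 4)} {i : Fin 4}
    {tr : ℕ} : ∀ (rts : List ((k × ℕ) × PNode6 k)), proots6B q rest G U' i tr rts = true →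
      ∀ (ρm : k × ℕ) (t : PNode6 k), (ρm, t) ∈ rts → pnode6B q rest (normT (shearMonoL i ρm.1 tr G)) U' t = true
  | [], _, _, _, hm => absurd hm List.not_mem_nil
  | (ρ₀, t₀) :: rts, h, ρm, t, hm => by
    simp only [proots6B, Bool.and_eq_true] at h
    rcases List.mem_cons.mp hm with hh | ht
    · rw [(Prod.mk.inj hh).1, (Prod.mk.inj hh).2]; exact h.1
    · exact pnode6B_of_mem_roots rts h.2 ρm t ht

/-- the subtree filed under a quadratic factor passes the node check on the reduced data, which is letter-free.
OURS. [folklore] -/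
theorem pnode6B_of_mem_quads {q : ℕ} {rest : List (PRow6 k)} {G : Terms 5 k} {U' : Finset (Fin 4)} {i : Fin 4} :
    ∀ (qds : List ((k × k × ℕ) × PNode6 k)), pquads6B q rest G U' i qds = true →
      ∀ (c : k × k × ℕ) (t : PNode6 k), (c, t) ∈ qds →
        tfreeB (normT (reduceQ c.1 c.2.1 (shearL i G))) = true ∧
          pnode6B q rest (normT (reduceQ c.1 c.2.1 (shearL i G))) U' t = true
  | [], _, _, _, hm => absurd hm List.not_mem_nil
  | (c₀, t₀) :: qds, h, c, t, hm => by
    simp only [pquads6B, Bool.and_eq_true] at h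
    rcases List.mem_cons.mp hm with hh | ht
    · rw [(Prod.mk.inj hh).1, (Prod.mk.inj hh).2]; exact h.1
    · exact pnode6B_of_mem_quads qds h.2 c t ht

end Format

end LoopCLocal

end Summit.ResolutionOfSingularities.ResolutionOfSingularities.Theorems.PIDim4

end
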